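import Mathlib.Analysis.Normed.Module.PiTensorProduct.ProjectiveSeminorm
import Mathlib.Analysis.Normed.Module.DoubleDual
import HarnessLib

/-!
# The projective tensor seminorm is a cross norm

Ryan, *Introduction to Tensor Products of Banach Spaces* (Springer, 2002), Ch. 2, Prop. 2.1
[cite: Ryan2002, Prop. 2.1]: for normed spaces `X, Y` the projective tensor norm `π` satisfies
`π(x ⊗ y) = ‖x‖ · ‖y‖` (the *cross-norm property*; Grothendieck 1953, Diestel–Fourie–Swart 2008
Thm. 1.1.3). The proof of `≥` evaluates `x ⊗ y` against `φ ⊗ ψ` for norming functionals `φ, ψ`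
(Hahn–Banach).

Mathlib (`Mathlib/Analysis/Normed/Module/PiTensorProduct/ProjectiveSeminorm.lean`) equips the
algebraic tensor product `⨂[𝕜] i, E i` of a finite family of seminormed spaces over a nontrivially
normed field `𝕜` with the projective seminorm as its norm and proves the easy half
`PiTensorProduct.projectiveSeminorm_tprod_le : ‖⨂ₜ[𝕜] i, m i‖ ≤ ∏ i, ‖m i‖`; the reverse inequality
is recorded there as a TODO ("if the injection of `Eᵢ` into its bidual is an isometry for every `i`,
then `projectiveSeminorm ⨂ₜ[𝕜] i, mᵢ = Π i, ‖mᵢ‖`"). This file proves it, in the finite-family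
(`PiTensorProduct`) generality of Mathlib:

* `prod_norm_dual_apply_le_norm_tprod_mul` — for continuous functionals `f i`,
  `∏ ‖f i (m i)‖ ≤ ‖⨂ₜ m‖ · ∏ ‖f i‖` (evaluate against the product functional);
* `prod_norm_le_of_dual_bound` — the abstract lower-bound mechanism: any quantity `q ≥ 0` obeying
  that dual bound dominates `∏ ‖m i‖` as soon as every `m i` is normed by the dual unit ball
  (`‖ι(m i)‖ = ‖m i‖`, `ι` = `NormedSpace.inclusionInDoubleDual`); this is the form that applies
  verbatim to any "reasonable" tensor seminorm sandwiched below the projective one;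
* `prod_norm_le_norm_tprod`, `norm_tprod_eq_prod_norm` — the cross-norm property under the
  bidual hypothesis, `norm_tprod_eq_prod_norm_of_isometry` — under the TODO's hypothesis literally;
* `norm_tprod_eq_prod_norm_rclike` — unconditionally over `ℝ`/`ℂ` (`RCLike`, Hahn–Banach via
  `NormedSpace.inclusionInDoubleDualLi`).

Over a non-archimedean field the bidual hypothesis is the existence of norming functionals
(spherical completeness / Ingleton); the non-archimedean "max"-projective norm of Schneider,
*Nonarchimedean Functional Analysis* §17 is NOT treated here. No new definitions; nothing specific
to any programme of the tree.
-/

namespace Literature.Analysis.OperatorTheory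

open scoped TensorProduct
open PiTensorProduct Filter
open _root_.Topology

universe uι u𝕜 uE

section NontriviallyNormedField

variable {ι : Type uι} [Fintype ι] {𝕜 : Type u𝕜} [NontriviallyNormedField 𝕜]
  {E : ι → Type uE} [∀ i, SeminormedAddCommGroup (E i)] [∀ i, NormedSpace 𝕜 (E i)]

/-- **Dual bound for elementary tensors.** For continuous linear functionals `f i : E i →L[𝕜] 𝕜`
and vectors `m i`, `∏ i, ‖f i (m i)‖ ≤ ‖⨂ₜ[𝕜] i, m i‖ * ∏ i, ‖f i‖`: evaluate the elementary tensor
against the product functional `(x_i)_i ↦ ∏ f i (x i)`, whose operator norm is `≤ ∏ ‖f i‖`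
(Ryan 2002, proof of Prop. 2.1). [cite: Ryan2002, Prop. 2.1] -/
theorem prod_norm_dual_apply_le_norm_tprod_mul (m : Π i, E i) (f : Π i, StrongDual 𝕜 (E i)) :
    ∏ i, ‖f i (m i)‖ ≤ ‖(⨂ₜ[𝕜] i, m i)‖ * ∏ i, ‖f i‖ := by
  set Φ : ContinuousMultilinearMap 𝕜 E 𝕜 :=
    (ContinuousMultilinearMap.mkPiAlgebra 𝕜 ι 𝕜).compContinuousLinearMap f with hΦ
  have h1 : ‖lift Φ.toMultilinearMap (⨂ₜ[𝕜] i, m i)‖ ≤ ‖Φ‖ * ‖(⨂ₜ[𝕜] i, m i)‖ :=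
    norm_eval_le_projectiveSeminorm Φ _
  have h2 : lift Φ.toMultilinearMap (⨂ₜ[𝕜] i, m i) = ∏ i, f i (m i) := by
    rw [lift.tprod, ContinuousMultilinearMap.coe_coe, hΦ,
      ContinuousMultilinearMap.compContinuousLinearMap_apply,
      ContinuousMultilinearMap.mkPiAlgebra_apply]
  have h3 : ‖Φ‖ ≤ ∏ i, ‖f i‖ := by
    calc ‖Φ‖ ≤ ‖ContinuousMultilinearMap.mkPiAlgebra 𝕜 ι 𝕜‖ * ∏ i, ‖f i‖ :=
          ContinuousMultilinearMap.norm_compContinuousLinearMap_le _ _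
      _ = ∏ i, ‖f i‖ := by rw [ContinuousMultilinearMap.norm_mkPiAlgebra, one_mul]
  rw [h2, norm_prod] at h1
  calc ∏ i, ‖f i (m i)‖ ≤ ‖Φ‖ * ‖(⨂ₜ[𝕜] i, m i)‖ := h1
    _ ≤ (∏ i, ‖f i‖) * ‖(⨂ₜ[𝕜] i, m i)‖ := by gcongr
    _ = ‖(⨂ₜ[𝕜] i, m i)‖ * ∏ i, ‖f i‖ := mul_comm _ _

/-- **The lower-bound mechanism** (Ryan 2002, proof of Prop. 2.1, abstracted). Let `q ≥ 0` be a
real number obeying the dual bound `∏ ‖f i (m i)‖ ≤ q * ∏ ‖f i‖` for all families of functionals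
`f` (e.g. the value at `⨂ₜ m` of the projective seminorm, or of any tensor seminorm dominating the
evaluations against product functionals). If every `m i` is normed by the dual unit ball, i.e.
`‖ι (m i)‖ = ‖m i‖` for the inclusion `ι` into the bidual, then `∏ ‖m i‖ ≤ q`. Proof: for
`0 < t < 1` pick `f i` with `t‖m i‖‖f i‖ < ‖f i (m i)‖`, multiply, cancel `∏ ‖f i‖ > 0`, and let
`t → 1`. [cite: Ryan2002, Prop. 2.1] -/
theorem prod_norm_le_of_dual_bound (m : Π i, E i)
    (h : ∀ i, ‖NormedSpace.inclusionInDoubleDual 𝕜 (E i) (m i)‖ = ‖m i‖) {q : ℝ} (hq : 0 ≤ q)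
    (hbound : ∀ f : Π i, StrongDual 𝕜 (E i), ∏ i, ‖f i (m i)‖ ≤ q * ∏ i, ‖f i‖) :
    ∏ i, ‖m i‖ ≤ q := by
  -- Step 1: for every `0 < t < 1`, `t ^ n * ∏ ‖m i‖ ≤ q`.
  have step : ∀ t : ℝ, 0 < t → t < 1 → t ^ Fintype.card ι * ∏ i, ‖m i‖ ≤ q := by
    intro t ht0 ht1
    by_cases hz : ∃ i, ‖m i‖ = 0
    · obtain ⟨i, hi⟩ := hz
      rw [Finset.prod_eq_zero (Finset.mem_univ i) hi, mul_zero]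
      exact hq
    push Not at hz
    have hpos : ∀ i, 0 < ‖m i‖ := fun i => lt_of_le_of_ne (norm_nonneg _) (Ne.symm (hz i))
    -- norming functionals up to the factor `t`
    have hf : ∀ i, ∃ f : StrongDual 𝕜 (E i), t * ‖m i‖ * ‖f‖ < ‖f (m i)‖ := by
      intro i
      by_contra H
      push Not at H
      have hle : ‖NormedSpace.inclusionInDoubleDual 𝕜 (E i) (m i)‖ ≤ t * ‖m i‖ :=
        ContinuousLinearMap.opNorm_le_bound _ (by positivity) fun g => by
          simpa only [NormedSpace.dual_def] using H g
      rw [h i] at hle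
      nlinarith [hpos i]
    choose f hf using hf
    have hfpos : ∀ i, 0 < ‖f i‖ := by
      intro i
      rcases (norm_nonneg (f i)).lt_or_eq with hlt | heq
      · exact hlt
      · have h0 : ‖f i (m i)‖ ≤ ‖f i‖ * ‖m i‖ := (f i).le_opNorm _
        rw [← heq, zero_mul] at h0
        have h1 := hf i
        rw [← heq, mul_zero] at h1
        exact absurd h0 (not_le.mpr h1)
    have hF : 0 < ∏ i, ‖f i‖ := Finset.prod_pos fun i _ => hfpos i
    have hprod : ∏ i, (t * ‖m i‖ * ‖f i‖) ≤ ∏ i, ‖f i (m i)‖ :=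
      Finset.prod_le_prod (fun i _ => by positivity) fun i _ => (hf i).le
    have hsplit : ∏ i, (t * ‖m i‖ * ‖f i‖) =
        t ^ Fintype.card ι * (∏ i, ‖m i‖) * ∏ i, ‖f i‖ := by
      rw [Finset.prod_mul_distrib, Finset.prod_mul_distrib, Finset.prod_const, Finset.card_univ]
    have hle : t ^ Fintype.card ι * (∏ i, ‖m i‖) * ∏ i, ‖f i‖ ≤ q * ∏ i, ‖f i‖ := by
      rw [← hsplit]
      exact hprod.trans (hbound f)
    exact le_of_mul_le_mul_right hle hF
  -- Step 2: let `t → 1⁻`.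
  have htend : Tendsto (fun t : ℝ => t ^ Fintype.card ι * ∏ i, ‖m i‖) (𝓝[<] 1)
      (𝓝 (∏ i, ‖m i‖)) := by
    have hc : Tendsto (fun t : ℝ => t ^ Fintype.card ι * ∏ i, ‖m i‖) (𝓝 1)
        (𝓝 ((1 : ℝ) ^ Fintype.card ι * ∏ i, ‖m i‖)) :=
      ((continuous_pow (Fintype.card ι)).mul continuous_const).tendsto 1
    rw [one_pow, one_mul] at hc
    exact hc.mono_left nhdsWithin_le_nhds
  refine le_of_tendsto htend ?_
  have hIoo : Set.Ioo (0 : ℝ) 1 ∈ 𝓝[<] (1 : ℝ) := Ioo_mem_nhdsLT zero_lt_one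
  filter_upwards [hIoo] with t ht using step t ht.1 ht.2

/-- **Lower bound of the cross-norm property** for Mathlib's projective tensor seminorm: if every
`m i` is normed by the dual unit ball (`‖ι (m i)‖ = ‖m i‖`), then `∏ i, ‖m i‖ ≤ ‖⨂ₜ[𝕜] i, m i‖`.
[cite: Ryan2002, Prop. 2.1] -/
theorem prod_norm_le_norm_tprod (m : Π i, E i)
    (h : ∀ i, ‖NormedSpace.inclusionInDoubleDual 𝕜 (E i) (m i)‖ = ‖m i‖) :
    ∏ i, ‖m i‖ ≤ ‖(⨂ₜ[𝕜] i, m i)‖ :=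
  prod_norm_le_of_dual_bound m h (norm_nonneg _) (prod_norm_dual_apply_le_norm_tprod_mul m)

/-- **Cross-norm property of the projective tensor seminorm** (Ryan 2002, Prop. 2.1
"`π(x ⊗ y) = ‖x‖‖y‖`", finite families): if every `m i` is normed by the dual unit ball, then
`‖⨂ₜ[𝕜] i, m i‖ = ∏ i, ‖m i‖`. [cite: Ryan2002, Prop. 2.1] -/
theorem norm_tprod_eq_prod_norm (m : Π i, E i)
    (h : ∀ i, ‖NormedSpace.inclusionInDoubleDual 𝕜 (E i) (m i)‖ = ‖m i‖) :
    ‖(⨂ₜ[𝕜] i, m i)‖ = ∏ i, ‖m i‖ :=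
  le_antisymm (projectiveSeminorm_tprod_le m) (prod_norm_le_norm_tprod m h)

/-- **Cross-norm property, Mathlib's TODO verbatim**: if for every `i` the injection of `E i` into
its bidual is an isometry, then `‖⨂ₜ[𝕜] i, m i‖ = ∏ i, ‖m i‖` for all `m`.
[cite: Ryan2002, Prop. 2.1] -/
theorem norm_tprod_eq_prod_norm_of_isometry
    (hiso : ∀ i, Isometry (NormedSpace.inclusionInDoubleDual 𝕜 (E i))) (m : Π i, E i) :
    ‖(⨂ₜ[𝕜] i, m i)‖ = ∏ i, ‖m i‖ :=
  norm_tprod_eq_prod_norm m fun i => by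
    have h := Isometry.norm_map_of_map_zero (f := ⇑(NormedSpace.inclusionInDoubleDual 𝕜 (E i)))
      (hiso i) (NormedSpace.inclusionInDoubleDual 𝕜 (E i)).map_zero (m i)
    exact h

end NontriviallyNormedField

section RCLike

variable {ι : Type uι} [Fintype ι] {𝕜 : Type u𝕜} [RCLike 𝕜]
  {E : ι → Type uE} [∀ i, SeminormedAddCommGroup (E i)] [∀ i, NormedSpace 𝕜 (E i)]

/-- **Cross-norm property over `ℝ` and `ℂ`** (Ryan 2002, Prop. 2.1; Diestel–Fourie–Swart 2008,
Thm. 1.1.3): for seminormed spaces over an `RCLike` field, `‖⨂ₜ[𝕜] i, m i‖ = ∏ i, ‖m i‖`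
unconditionally — the bidual embedding is an isometry by Hahn–Banach
(`NormedSpace.inclusionInDoubleDualLi`). [cite: Ryan2002, Prop. 2.1] -/
theorem norm_tprod_eq_prod_norm_rclike (m : Π i, E i) : ‖(⨂ₜ[𝕜] i, m i)‖ = ∏ i, ‖m i‖ :=
  norm_tprod_eq_prod_norm m fun i => (NormedSpace.inclusionInDoubleDualLi (E := E i) 𝕜).norm_map (m i)

/-- Over `ℝ`/`ℂ`, elementary tensors of nonzero-norm vectors have nonzero norm (in particular the
projective seminorm does not vanish on them). [cite: Ryan2002, Prop. 2.1] -/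
theorem norm_tprod_pos_rclike (m : Π i, E i) (hm : ∀ i, ‖m i‖ ≠ 0) : 0 < ‖(⨂ₜ[𝕜] i, m i)‖ := by
  rw [norm_tprod_eq_prod_norm_rclike m]
  exact Finset.prod_pos fun i _ => lt_of_le_of_ne (norm_nonneg _) (Ne.symm (hm i))

end RCLike

end Literature.Analysis.OperatorTheory
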